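import Mathlib.Geometry.Manifold.PartitionOfUnity
import Mathlib.Analysis.SpecialFunctions.Sqrt
import Literature.Geometry.Riemannian.RicciDeTurckChartFamily
import Literature.Geometry.Riemannian.PullbackFamilyDerivative
import HarnessLib

/-!
# Assembling symmetric bilinear forms on `TM` from vector-valued functions on `M`
(topic `Geometry/Riemannian`)

Auxiliary layer for the reduction of short-time existence of the Ricci–DeTurck flow
(`Literature.Geometry.Riemannian.ricciFlow_shortTime_existence_of_ricciDeTurck`,
`RicciFlowExistenceReduction.lean`; Topping 2006, §5.2, Step 1) to a short-time existence
theorem for quasilinear strictly parabolic systems for PLAIN vector-valued maps `u : M → W` on a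
closed manifold (Taylor, *PDE III*, §15.8; Mantegazza–Martinazzi 2012, Thm. 1.1). A metric is a
section of the bundle `Hom(TM, Hom(TM, ℝ))`, not a vector-valued function; the standard device
(every vector bundle over a compact base is a direct summand of a trivial bundle, Milnor–Stasheff
1974, Lemma 5.3 / Husemoller, *Fibre Bundles*, Ch. 3, Prop. 5.8, built from a finite partition
of unity subordinate to bundle charts) realises the bundle of bilinear forms as a retract of the
trivial bundle `M × (Fin N → (E →L E →L ℝ))`:

* `ChartCover I M N` — a finite family of `C^∞` functions `ρᵢ` with `∑ᵢ ρᵢ² = 1`, each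
  supported in the domain of the preferred chart at a centre `cᵢ` (`ChartCover.exists` on a
  compact Hausdorff manifold, from Mathlib's `SmoothBumpCovering`);
* `ChartCover.embed` (`ℰ`) — a family `s` of bilinear forms on the tangent spaces read as the
  vector-valued function `x ↦ (ρᵢ(x) · s_x(eᵢ⁻¹ ·, eᵢ⁻¹ ·))ᵢ`, `eᵢ` the trivialization of `TM`
  at `cᵢ`;
* `ChartCover.assemble` (`𝒜`) — a vector-valued function `U : M → (Fin N → (E →L E →L ℝ))`
  read back as the family of SYMMETRIC bilinear forms `x ↦ ∑ᵢ ρᵢ(x) · sym(Uᵢ(x))(eᵢ ·, eᵢ ·)`;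
* `assemble_embed` — `𝒜 ∘ ℰ = sym` (the identity on symmetric families): the retraction;
* smoothness both ways (`contMDiffWithinAt_assembleAt`, `contMDiffWithinAt_embedAt`,
  `contMDiff_embed`, `contMDiffOn_embed_family`, `contMDiff_assemble`,
  `contMDiffOn_assemble_family`) and the coefficient map `coeffCLM` expressing the components
  of `𝒜 U` in the chart at `z` as a smooth family of linear maps applied to `U`
  (`chartRep_eq_coeffCLM`, `contMDiffOn_coeffCLM`, `contDiffOn_coeffCLM_symm`);
* the frame maps of the trivializations of `TM` at the model type (`trivCLM`, `trivSymmL`) and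
  their composite as Mathlib's coordinate change (`trivCLM_comp_trivSymmL`).

Everything is proved; no named fact and no `sorry` is introduced.

## References

* J. W. Milnor, J. D. Stasheff, *Characteristic classes*, Ann. of Math. Stud. 76 (1974),
  Lemma 5.3 and its proof (every bundle over a compact base is a direct summand of a trivial
  bundle). [MilnorStasheff1974]
* P. Topping, *Lectures on the Ricci flow*, LMS LNS 325 (2006), §5.2. [Topping2006]
-/

noncomputable section

set_option maxSynthPendingDepth 3

open Bundle Set Function Filter ContinuousLinearMap TopologicalSpace
open scoped Manifold ContDiff Topology

namespace Literature.Geometry.Riemannian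

open Lorentzian Lorentzian.PseudoRiemannianMetric

/-! ### Symmetrisation and linear pullback of bilinear forms, as continuous linear maps -/

section LinearAlgebra

variable {E : Type*} [NormedAddCommGroup E] [NormedSpace ℝ E]
  {F : Type*} [NormedAddCommGroup F] [NormedSpace ℝ F]

variable (E) in
/-- **Symmetrisation** `sym B (v, w) = ½ (B(v, w) + B(w, v))` of continuous bilinear forms on
`E`, as a continuous linear map. [folklore] -/
def symCLM : (E →L[ℝ] E →L[ℝ] ℝ) →L[ℝ] (E →L[ℝ] E →L[ℝ] ℝ) where
  toFun B := (2⁻¹ : ℝ) • (B + B.flip)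
  map_add' B B' := by
    simp only [ContinuousLinearMap.flip_add, smul_add]
    abel
  map_smul' c B := by
    simp only [ContinuousLinearMap.flip_smul, RingHom.id_apply, smul_add, smul_comm c]
  cont := (continuous_id.add (ContinuousLinearMap.flipₗᵢ ℝ E E ℝ).continuous).const_smul (2⁻¹ : ℝ)

/-- `sym B (v, w) = ½ (B(v, w) + B(w, v))`. [folklore] -/
@[simp]
theorem symCLM_apply (B : E →L[ℝ] E →L[ℝ] ℝ) (v w : E) :
    symCLM E B v w = 2⁻¹ * (B v w + B w v) := by
  simp only [symCLM, ContinuousLinearMap.coe_mk', LinearMap.coe_mk, AddHom.coe_mk]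
  rw [_root_.smul_apply, _root_.add_apply, _root_.smul_apply, _root_.add_apply,
    ContinuousLinearMap.flip_apply, smul_eq_mul]

/-- The symmetrisation is symmetric. [folklore] -/
theorem symCLM_symm (B : E →L[ℝ] E →L[ℝ] ℝ) (v w : E) : symCLM E B v w = symCLM E B w v := by
  rw [symCLM_apply, symCLM_apply, add_comm]

/-- The symmetrisation of a symmetric form is the form. [folklore] -/
theorem symCLM_of_symm {B : E →L[ℝ] E →L[ℝ] ℝ} (hB : ∀ v w, B v w = B w v) : symCLM E B = B := by
  ext v w
  rw [symCLM_apply, hB w v]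
  ring

/-- **Linear pullback of bilinear forms** along `T : F →L E` as a continuous linear map:
`pullCLM T B (a, b) = B (T a, T b)`. [folklore] -/
def pullCLM (T : F →L[ℝ] E) : (E →L[ℝ] E →L[ℝ] ℝ) →L[ℝ] (F →L[ℝ] F →L[ℝ] ℝ) :=
  ((ContinuousLinearMap.compL ℝ F (E →L[ℝ] ℝ) (F →L[ℝ] ℝ))
      (T.precomp ℝ : (E →L[ℝ] ℝ) →L[ℝ] (F →L[ℝ] ℝ))).comp
    ((ContinuousLinearMap.compL ℝ F E (E →L[ℝ] ℝ)).flip T)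

/-- `pullCLM T B a b = B (T a) (T b)`. [folklore] -/
@[simp]
theorem pullCLM_apply (T : F →L[ℝ] E) (B : E →L[ℝ] E →L[ℝ] ℝ) (a b : F) :
    pullCLM T B a b = B (T a) (T b) := by
  simp only [pullCLM, ContinuousLinearMap.coe_comp, comp_apply, ContinuousLinearMap.flip_apply,
    ContinuousLinearMap.compL_apply, ContinuousLinearMap.precomp_apply]

/-- `pullCLM T B = B.bilinearComp T T`. [folklore] -/
theorem pullCLM_eq_bilinearComp (T : F →L[ℝ] E) (B : E →L[ℝ] E →L[ℝ] ℝ) :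
    pullCLM T B = B.bilinearComp T T := by
  ext a b
  rw [pullCLM_apply, bilinearComp_apply]

/-- **Smoothness of `T ↦ pullCLM T` along a `C^n` family of linear maps** (within a set).
[folklore] -/
theorem contDiffWithinAt_pullCLM {X : Type*} [NormedAddCommGroup X] [NormedSpace ℝ X]
    {n : ℕ∞ω} {T : X → F →L[ℝ] E} {s : Set X} {x : X} (hT : ContDiffWithinAt ℝ n T s x) :
    ContDiffWithinAt ℝ n (fun y ↦ pullCLM (T y)) s x := by
  have h1 : ContDiffWithinAt ℝ n
      (fun y ↦ ((T y).precomp (E →L[ℝ] ℝ) : (E →L[ℝ] E →L[ℝ] ℝ) →L[ℝ] (F →L[ℝ] E →L[ℝ] ℝ)))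
      s x := by
    have h := (contMDiffWithinAt_iff_contDiffWithinAt.2 hT).clm_precomp (F₃ := E →L[ℝ] ℝ)
    exact contMDiffWithinAt_iff_contDiffWithinAt.1 h
  have h2 : ContDiffWithinAt ℝ n
      (fun y ↦ (((T y).precomp ℝ : (E →L[ℝ] ℝ) →L[ℝ] (F →L[ℝ] ℝ)).postcomp F :
        (F →L[ℝ] E →L[ℝ] ℝ) →L[ℝ] (F →L[ℝ] F →L[ℝ] ℝ))) s x := by
    have h := (contMDiffWithinAt_iff_contDiffWithinAt.2 hT).clm_precomp (F₃ := ℝ)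
    have h' := h.clm_postcomp (F₁ := F)
    exact contMDiffWithinAt_iff_contDiffWithinAt.1 h'
  have heq : ∀ y, pullCLM (T y) =
      ((((T y).precomp ℝ : (E →L[ℝ] ℝ) →L[ℝ] (F →L[ℝ] ℝ)).postcomp F :
        (F →L[ℝ] E →L[ℝ] ℝ) →L[ℝ] (F →L[ℝ] F →L[ℝ] ℝ))).comp
        ((T y).precomp (E →L[ℝ] ℝ) : (E →L[ℝ] E →L[ℝ] ℝ) →L[ℝ] (F →L[ℝ] E →L[ℝ] ℝ)) := by
    intro y
    ext B a b
    simp only [pullCLM_apply, ContinuousLinearMap.coe_comp, comp_apply,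
      ContinuousLinearMap.postcomp_apply, ContinuousLinearMap.precomp_apply]
  exact (h2.clm_comp h1).congr (fun y _ ↦ heq y) (heq x)

/-- `ContDiffOn` version of `contDiffWithinAt_pullCLM`. [folklore] -/
theorem contDiffOn_pullCLM {X : Type*} [NormedAddCommGroup X] [NormedSpace ℝ X]
    {n : ℕ∞ω} {T : X → F →L[ℝ] E} {s : Set X} (hT : ContDiffOn ℝ n T s) :
    ContDiffOn ℝ n (fun y ↦ pullCLM (T y)) s := fun x hx ↦
  contDiffWithinAt_pullCLM (hT x hx)

/-- `T ↦ pullCLM T` is a smooth (polynomial) map. [folklore] -/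
theorem contDiff_pullCLM {n : ℕ∞ω} :
    ContDiff ℝ n (fun T : F →L[ℝ] E ↦ pullCLM T) := by
  rw [← contDiffOn_univ]
  exact contDiffOn_pullCLM contDiffOn_id

/-- Composition of linear pullbacks: `pullCLM (A ∘ B) = pullCLM B ∘ pullCLM A`. [folklore] -/
theorem pullCLM_comp {G : Type*} [NormedAddCommGroup G] [NormedSpace ℝ G] (A : F →L[ℝ] E)
    (B : G →L[ℝ] F) (X : E →L[ℝ] E →L[ℝ] ℝ) :
    pullCLM (A.comp B) X = pullCLM B (pullCLM A X) := by
  ext a b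
  simp only [pullCLM_apply, ContinuousLinearMap.coe_comp, comp_apply]

end LinearAlgebra

/-! ### Finite chart covers with `∑ ρᵢ² = 1` -/

section Cover

variable {E : Type*} [NormedAddCommGroup E] [NormedSpace ℝ E] {H : Type*} [TopologicalSpace H]
  (I : ModelWithCorners ℝ E H) (M : Type*) [TopologicalSpace M] [ChartedSpace H M]

/-- **A finite chart cover with a quadratic partition of unity**: finitely many centres `cᵢ`
and `C^∞` functions `ρᵢ : M → ℝ` with `tsupport ρᵢ ⊆ (chartAt H cᵢ).source` and
`∑ᵢ ρᵢ(x)² = 1` for all `x` (the normalisation `∑ ρᵢ² = 1`, rather than `∑ ρᵢ = 1`, makes the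
assembling map `𝒜` a left inverse of the embedding `ℰ`, `ChartCover.assemble_embed`). This is
the datum from which a vector bundle over a compact base is exhibited as a direct summand of a
trivial bundle (Milnor–Stasheff 1974, proof of Lemma 5.3). [folklore] -/
structure ChartCover (N : ℕ) where
  /-- The centres of the charts. -/
  center : Fin N → M
  /-- The functions of the quadratic partition of unity. -/
  ρ : Fin N → M → ℝ
  /-- Each `ρᵢ` is `C^∞`. -/
  contMDiff_ρ : ∀ i, ContMDiff I 𝓘(ℝ, ℝ) ∞ (ρ i)
  /-- Each `ρᵢ` is supported in the domain of the preferred chart at its centre. -/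
  tsupport_subset : ∀ i, tsupport (ρ i) ⊆ (chartAt H (center i)).source
  /-- `∑ᵢ ρᵢ² = 1`. -/
  sum_sq_eq_one : ∀ x, ∑ i, ρ i x ^ 2 = 1

/-- **Existence of finite chart covers on a compact Hausdorff manifold**: take a finite smooth
bump covering (Mathlib's `SmoothBumpCovering.exists_isSubordinate`, finite by compactness),
whose functions `bᵢ` are supported in the chart domains at their centres and one of which equals
`1` near each point, and normalise: `ρᵢ = bᵢ / (∑ⱼ bⱼ²)^{1/2}`. [folklore] -/
theorem ChartCover.exists [FiniteDimensional ℝ E] [T2Space M] [CompactSpace M]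
    [IsManifold I ∞ M] : ∃ N, Nonempty (ChartCover I M N) := by
  obtain ⟨ι, fs, -⟩ := SmoothBumpCovering.exists_isSubordinate I (M := M) (s := univ)
    (U := fun _ ↦ univ) isClosed_univ (fun x _ ↦ univ_mem)
  haveI : Fintype ι := fs.fintype
  set e := Fintype.equivFin ι with he
  set N := Fintype.card ι with hN
  -- the bump functions, reindexed by `Fin N`
  set bf : Fin N → M → ℝ := fun i x ↦ fs (e.symm i) x with hbf
  have hbs : ∀ i, ContMDiff I 𝓘(ℝ, ℝ) ∞ (bf i) := fun i ↦ (fs (e.symm i)).contMDiff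
  set S : M → ℝ := fun x ↦ ∑ i, bf i x ^ 2 with hS
  have hS1 : ∀ x, 1 ≤ S x := by
    intro x
    have h1 : fs (fs.ind x (mem_univ x)) x = 1 := fs.apply_ind x (mem_univ x)
    have hle : bf (e (fs.ind x (mem_univ x))) x ^ 2 ≤ S x := by
      refine Finset.single_le_sum (f := fun i ↦ bf i x ^ 2) (fun i _ ↦ sq_nonneg _)
        (Finset.mem_univ _)
    have hval : bf (e (fs.ind x (mem_univ x))) x = 1 := by
      show fs (e.symm (e (fs.ind x (mem_univ x)))) x = 1
      rw [Equiv.symm_apply_apply]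
      exact h1
    rw [hval, one_pow] at hle
    exact hle
  have hSpos : ∀ x, 0 < S x := fun x ↦ lt_of_lt_of_le one_pos (hS1 x)
  have hSs : ContMDiff I 𝓘(ℝ, ℝ) ∞ S :=
    ContMDiff.sum (t := Finset.univ) (f := fun i x ↦ bf i x ^ 2) fun i _ ↦ (hbs i).pow 2
  -- the normalising factor `(S x)^{-1/2}`
  set q : M → ℝ := fun x ↦ (Real.sqrt (S x))⁻¹ with hq
  have hqs : ContMDiff I 𝓘(ℝ, ℝ) ∞ q := by
    intro x
    have h1 : ContDiffAt ℝ ∞ (fun r : ℝ ↦ (Real.sqrt r)⁻¹) (S x) := by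
      have hsq : ContDiffAt ℝ ∞ Real.sqrt (S x) := Real.contDiffAt_sqrt (hSpos x).ne'
      exact hsq.inv (Real.sqrt_ne_zero'.2 (hSpos x))
    exact h1.comp_contMDiffAt (hSs x)
  have hsupp : ∀ i, tsupport (fun x ↦ bf i x * q x) ⊆ (chartAt H (fs.c (e.symm i))).source :=
    fun i ↦ (tsupport_mul_subset_left (f := bf i) (g := q)).trans
      (fs (e.symm i)).tsupport_subset_chartAt_source
  have hsum : ∀ x, ∑ i, (bf i x * q x) ^ 2 = 1 := by
    intro x
    have hsq : Real.sqrt (S x) ^ 2 = S x := Real.sq_sqrt (hSpos x).le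
    have hne : S x ≠ 0 := (hSpos x).ne'
    simp only [mul_pow, hq, inv_pow, hsq, ← Finset.sum_mul]
    exact mul_inv_cancel₀ hne
  exact ⟨N, ⟨⟨fun i ↦ fs.c (e.symm i), fun i x ↦ bf i x * q x, fun i ↦ (hbs i).mul hqs, hsupp,
    hsum⟩⟩⟩

end Cover


/-! ### The frame maps of the trivializations of `TM`, at the model type -/

section Frame

variable {E : Type*} [NormedAddCommGroup E] [NormedSpace ℝ E] {H : Type*} [TopologicalSpace H]
  {I : ModelWithCorners ℝ E H} {M : Type*} [TopologicalSpace M] [ChartedSpace H M]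
  [IsManifold I ∞ M]

variable (I) in
/-- The frame map `T_x M → E` of the trivialization of `TM` at `x₀`, at the model type `E`
(`TangentSpace I x = E` definitionally; on the chart domain of `x₀` this is the differential of
the extended chart at `x₀`, Mathlib's `TangentBundle.continuousLinearMapAt_trivializationAt`).
[folklore] -/
def trivCLM (x₀ x : M) : E →L[ℝ] E :=
  (trivializationAt E (TangentSpace I : M → Type _) x₀).continuousLinearMapAt ℝ x

variable (I) in
/-- The inverse frame map `E → T_x M` of the trivialization of `TM` at `x₀`, at the model type.
[folklore] -/
def trivSymmL (x₀ x : M) : E →L[ℝ] E :=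
  (trivializationAt E (TangentSpace I : M → Type _) x₀).symmL ℝ x

/-- Chart domains are base sets of the trivializations of `TM`. [folklore] -/
theorem mem_baseSet_of_mem_source {x₀ x : M} (hx : x ∈ (chartAt H x₀).source) :
    x ∈ (trivializationAt E (TangentSpace I : M → Type _) x₀).baseSet := by
  simpa using hx

/-- `e⁻¹ (e v) = v` on the chart domain. [folklore] -/
theorem trivSymmL_trivCLM {x₀ x : M} (hx : x ∈ (chartAt H x₀).source) (v : E) :
    trivSymmL I x₀ x (trivCLM I x₀ x v) = v :=
  Trivialization.symmL_continuousLinearMapAt _ (mem_baseSet_of_mem_source hx) v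

/-- `e (e⁻¹ a) = a` on the chart domain. [folklore] -/
theorem trivCLM_trivSymmL {x₀ x : M} (hx : x ∈ (chartAt H x₀).source) (a : E) :
    trivCLM I x₀ x (trivSymmL I x₀ x a) = a :=
  Trivialization.continuousLinearMapAt_symmL _ (mem_baseSet_of_mem_source hx) a

/-- **The frame composite is the coordinate change of `TM`**: on the common chart domain,
`e_{x₁} ∘ e_{x₀}⁻¹ = coordChangeL (e_{x₀}) (e_{x₁})`. [folklore] -/
theorem trivCLM_comp_trivSymmL {x₀ x₁ x : M} (hx₀ : x ∈ (chartAt H x₀).source)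
    (hx₁ : x ∈ (chartAt H x₁).source) :
    (trivCLM I x₁ x).comp (trivSymmL I x₀ x) =
      ((trivializationAt E (TangentSpace I : M → Type _) x₀).coordChangeL ℝ
        (trivializationAt E (TangentSpace I : M → Type _) x₁) x : E →L[ℝ] E) := by
  have hb₀ := mem_baseSet_of_mem_source (I := I) hx₀
  have hb₁ := mem_baseSet_of_mem_source (I := I) hx₁
  ext v
  have h1 : trivSymmL I x₀ x v = (trivializationAt E (TangentSpace I : M → Type _) x₀).symm x v :=
    Trivialization.symmL_apply _ hb₀ v
  have h2 : trivCLM I x₁ x ((trivializationAt E (TangentSpace I : M → Type _) x₀).symm x v) =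
      ((trivializationAt E (TangentSpace I : M → Type _) x₁)
        ⟨x, (trivializationAt E (TangentSpace I : M → Type _) x₀).symm x v⟩).2 :=
    Trivialization.continuousLinearMapAt_apply_of_mem ℝ _ hb₁ _
  have h3 := Trivialization.coordChangeL_apply (R := ℝ)
    (trivializationAt E (TangentSpace I : M → Type _) x₀)
    (trivializationAt E (TangentSpace I : M → Type _) x₁) ⟨hb₀, hb₁⟩ v
  calc trivCLM I x₁ x (trivSymmL I x₀ x v)
      = trivCLM I x₁ x ((trivializationAt E (TangentSpace I : M → Type _) x₀).symm x v) :=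
        congrArg (trivCLM I x₁ x) h1
    _ = _ := h2
    _ = _ := h3.symm

/-- The coordinate expression of a bilinear form in the trivialization at `x₀` (the map of
`contMDiffWithinAt_bilin_iff`, `PullbackFamilyDerivative.lean`) is the linear pullback along
the inverse frame: `(e⁻¹)ᵀ B e⁻¹ = pullCLM e⁻¹ B`. [folklore] -/
theorem precomp_comp_comp_symmL_eq_pullCLM (x₀ x : M)
    (B : TangentSpace I x →L[ℝ] TangentSpace I x →L[ℝ] ℝ) :
    (ContinuousLinearMap.precomp ℝ
        ((trivializationAt E (TangentSpace I : M → Type _) x₀).symmL ℝ x)).comp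
      (B.comp ((trivializationAt E (TangentSpace I : M → Type _) x₀).symmL ℝ x)) =
      pullCLM (trivSymmL I x₀ x) B := by
  ext a a'
  rfl

end Frame

namespace ChartCover

variable {E : Type*} [NormedAddCommGroup E] [NormedSpace ℝ E] {H : Type*} [TopologicalSpace H]
  {I : ModelWithCorners ℝ E H} {M : Type*} [TopologicalSpace M] [ChartedSpace H M] {N : ℕ}
  (𝒞 : ChartCover I M N)

/-! ### Frames -/

section Frames

variable [IsManifold I ∞ M]

/-- The frame map `T_x M → E` of the trivialization of `TM` at the centre `cᵢ` (at the model
type). [folklore] -/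
abbrev τ (i : Fin N) (x : M) : E →L[ℝ] E := trivCLM I (𝒞.center i) x

/-- The inverse frame map `E → T_x M` of the trivialization of `TM` at the centre `cᵢ` (at the
model type). [folklore] -/
abbrev σ (i : Fin N) (x : M) : E →L[ℝ] E := trivSymmL I (𝒞.center i) x

omit [IsManifold I ∞ M] in
/-- A point where `ρᵢ ≠ 0` lies in the chart domain at `cᵢ`. [folklore] -/
theorem mem_source_of_ne_zero {i : Fin N} {x : M} (h : 𝒞.ρ i x ≠ 0) :
    x ∈ (chartAt H (𝒞.center i)).source :=
  𝒞.tsupport_subset i (subset_tsupport _ h)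

/-- On the chart domain the frame maps are inverse to each other: `σᵢ (τᵢ v) = v`. [folklore] -/
theorem σ_τ {i : Fin N} {x : M} (hx : x ∈ (chartAt H (𝒞.center i)).source) (v : E) :
    𝒞.σ i x (𝒞.τ i x v) = v :=
  trivSymmL_trivCLM hx v

/-- On the chart domain the frame maps are inverse to each other: `τᵢ (σᵢ a) = a`. [folklore] -/
theorem τ_σ {i : Fin N} {x : M} (hx : x ∈ (chartAt H (𝒞.center i)).source) (a : E) :
    𝒞.τ i x (𝒞.σ i x a) = a :=
  trivCLM_trivSymmL hx a

end Frames

/-! ### The embedding `ℰ` and the assembling map `𝒜` -/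

section EmbedAssemble

variable [IsManifold I ∞ M]

/-- **The embedding `ℰ`**: a family `s` of bilinear forms on the tangent spaces of `M`, read as
the vector-valued function `x ↦ (ρᵢ(x) · s_x(σᵢ ·, σᵢ ·))ᵢ` with values in
`Fin N → (E →L E →L ℝ)`. [folklore] -/
def embed (s : Π x : M, TangentSpace I x →L[ℝ] TangentSpace I x →L[ℝ] ℝ) (x : M) :
    Fin N → (E →L[ℝ] E →L[ℝ] ℝ) :=
  fun i ↦ 𝒞.ρ i x • pullCLM (𝒞.σ i x) (s x)

/-- `(ℰ s)(x)ᵢ (a, b) = ρᵢ(x) s_x(σᵢ a, σᵢ b)`. [folklore] -/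
@[simp]
theorem embed_apply (s : Π x : M, TangentSpace I x →L[ℝ] TangentSpace I x →L[ℝ] ℝ) (x : M)
    (i : Fin N) (a b : E) : 𝒞.embed s x i a b = 𝒞.ρ i x * s x (𝒞.σ i x a) (𝒞.σ i x b) := by
  simp only [embed]
  rw [_root_.smul_apply, _root_.smul_apply, pullCLM_apply, smul_eq_mul]
  rfl

/-- **The assembling map `𝒜` at a point**: a value `w : Fin N → (E →L E →L ℝ)` read as the
symmetric bilinear form `∑ᵢ ρᵢ(x) · sym(wᵢ)(τᵢ ·, τᵢ ·)` on `T_x M`. [folklore] -/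
def assembleAt (w : Fin N → (E →L[ℝ] E →L[ℝ] ℝ)) (x : M) :
    TangentSpace I x →L[ℝ] TangentSpace I x →L[ℝ] ℝ :=
  ∑ i, 𝒞.ρ i x • pullCLM (𝒞.τ i x) (symCLM E (w i))

/-- **The assembling map `𝒜`**: `𝒜 U (x) = ∑ᵢ ρᵢ(x) · sym(Uᵢ(x))(τᵢ ·, τᵢ ·)`. [folklore] -/
def assemble (U : M → Fin N → (E →L[ℝ] E →L[ℝ] ℝ)) (x : M) :
    TangentSpace I x →L[ℝ] TangentSpace I x →L[ℝ] ℝ :=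
  𝒞.assembleAt (U x) x

/-- `𝒜` at a point, evaluated. [folklore] -/
theorem assembleAt_apply (w : Fin N → (E →L[ℝ] E →L[ℝ] ℝ)) (x : M) (v v' : TangentSpace I x) :
    𝒞.assembleAt w x v v' = ∑ i, 𝒞.ρ i x * symCLM E (w i) (𝒞.τ i x v) (𝒞.τ i x v') := by
  simp only [assembleAt]
  change (∑ i, 𝒞.ρ i x • pullCLM (𝒞.τ i x) (symCLM E (w i))) v v' = _
  rw [_root_.sum_apply, _root_.sum_apply]
  refine Finset.sum_congr rfl fun i _ ↦ ?_
  rw [_root_.smul_apply, _root_.smul_apply, pullCLM_apply, smul_eq_mul]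

/-- `𝒜 U (x)(v, v') = ∑ᵢ ρᵢ(x) sym(Uᵢ x)(τᵢ v, τᵢ v')`. [folklore] -/
theorem assemble_apply (U : M → Fin N → (E →L[ℝ] E →L[ℝ] ℝ)) (x : M) (v v' : TangentSpace I x) :
    𝒞.assemble U x v v' = ∑ i, 𝒞.ρ i x * symCLM E (U x i) (𝒞.τ i x v) (𝒞.τ i x v') :=
  𝒞.assembleAt_apply (U x) x v v'

/-- `𝒜` takes values in symmetric forms. [folklore] -/
theorem assembleAt_symm (w : Fin N → (E →L[ℝ] E →L[ℝ] ℝ)) (x : M) (v v' : TangentSpace I x) :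
    𝒞.assembleAt w x v v' = 𝒞.assembleAt w x v' v := by
  rw [assembleAt_apply, assembleAt_apply]
  exact Finset.sum_congr rfl fun i _ ↦ by rw [symCLM_symm]

/-- `𝒜 U` is a family of symmetric forms. [folklore] -/
theorem assemble_symm (U : M → Fin N → (E →L[ℝ] E →L[ℝ] ℝ)) (x : M) (v v' : TangentSpace I x) :
    𝒞.assemble U x v v' = 𝒞.assemble U x v' v :=
  𝒞.assembleAt_symm (U x) x v v'

/-- **`𝒜 ∘ ℰ = sym`**: assembling the embedded family gives back its symmetrisation,
`𝒜 (ℰ s) (x)(v, v') = ½ (s_x(v, v') + s_x(v', v))` (on the support of `ρᵢ` the frame maps are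
inverse to each other, and `∑ ρᵢ² = 1`). [folklore] -/
theorem assemble_embed (s : Π x : M, TangentSpace I x →L[ℝ] TangentSpace I x →L[ℝ] ℝ) (x : M)
    (v v' : TangentSpace I x) :
    𝒞.assemble (𝒞.embed s) x v v' = 2⁻¹ * (s x v v' + s x v' v) := by
  rw [assemble_apply]
  have hterm : ∀ i, 𝒞.ρ i x * symCLM E (𝒞.embed s x i) (𝒞.τ i x v) (𝒞.τ i x v') =
      𝒞.ρ i x ^ 2 * (2⁻¹ * (s x v v' + s x v' v)) := by
    intro i
    by_cases h : 𝒞.ρ i x = 0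
    · simp [h]
    · have hx := 𝒞.mem_source_of_ne_zero h
      rw [symCLM_apply, embed_apply, embed_apply, 𝒞.σ_τ hx, 𝒞.σ_τ hx]
      ring
  simp_rw [hterm]
  rw [← Finset.sum_mul, 𝒞.sum_sq_eq_one x, one_mul]

/-- `𝒜 (ℰ s) = s` for a symmetric family `s`. [folklore] -/
theorem assemble_embed_of_symm {s : Π x : M, TangentSpace I x →L[ℝ] TangentSpace I x →L[ℝ] ℝ}
    (hs : ∀ x v v', s x v v' = s x v' v) : 𝒞.assemble (𝒞.embed s) = s := by
  funext x
  ext v v'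
  rw [assemble_embed, hs x v' v]
  ring

end EmbedAssemble

/-! ### Smoothness of the assembling map -/

section Smoothness

variable [IsManifold I ∞ M]
  {EX : Type*} [NormedAddCommGroup EX] [NormedSpace ℝ EX] {HX : Type*} [TopologicalSpace HX]
  {IX : ModelWithCorners ℝ EX HX} {Xm : Type*} [TopologicalSpace Xm] [ChartedSpace HX Xm]

/-- The coordinate change between the trivializations of `TM` at `x₀` and at the centre `cᵢ`
is `τᵢ ∘ e_{x₀}⁻¹` on the common domain. [folklore] -/
theorem τ_comp_trivSymmL_eq_coordChangeL (i : Fin N) (x₀ : M) {x : M}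
    (hx₀ : x ∈ (chartAt H x₀).source) (hxi : x ∈ (chartAt H (𝒞.center i)).source) :
    (𝒞.τ i x).comp (trivSymmL I x₀ x) =
      ((trivializationAt E (TangentSpace I : M → Type _) x₀).coordChangeL ℝ
        (trivializationAt E (TangentSpace I : M → Type _) (𝒞.center i)) x : E →L[ℝ] E) :=
  trivCLM_comp_trivSymmL hx₀ hxi

/-- **The assembling map is smooth**: along maps `β : X → M` and `U : X → (Fin N → V)` of class
`C^k` within `A` at `p₀`, the section `p ↦ 𝒜 (U p) (β p)` of the bundle of bilinear forms over
`β` is `C^k` within `A` at `p₀` (each term is, near `p₀`, either identically zero or the product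
of the smooth `ρᵢ ∘ β`, the smooth coordinate change of `TM` between the trivializations at
`β p₀` and at `cᵢ`, and `sym ∘ Uᵢ`). [folklore] -/
theorem contMDiffWithinAt_assembleAt {β : Xm → M} {U : Xm → Fin N → (E →L[ℝ] E →L[ℝ] ℝ)}
    {A : Set Xm} {p₀ : Xm} (hβ : ContMDiffWithinAt IX I ∞ β A p₀)
    (hU : ∀ i, ContMDiffWithinAt IX 𝓘(ℝ, E →L[ℝ] E →L[ℝ] ℝ) ∞ (fun p ↦ U p i) A p₀) :
    ContMDiffWithinAt IX (I.prod 𝓘(ℝ, E →L[ℝ] E →L[ℝ] ℝ)) ∞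
      (fun p ↦ TotalSpace.mk' (E →L[ℝ] E →L[ℝ] ℝ)
        (E := fun b : M ↦ TangentSpace I b →L[ℝ] TangentSpace I b →L[ℝ] ℝ) (β p)
        (𝒞.assembleAt (U p) (β p))) A p₀ := by
  rw [contMDiffWithinAt_bilin_iff]
  refine ⟨hβ, ?_⟩
  have hb₀' : β p₀ ∈ (chartAt H (β p₀)).source := mem_chart_source H (β p₀)
  -- the coordinate expression is `∑ᵢ ρᵢ(β p) • pullCLM (τᵢ ∘ e₀⁻¹) (sym (U p i))`
  have key : ∀ p, (ContinuousLinearMap.precomp ℝ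
      ((trivializationAt E (TangentSpace I : M → Type _) (β p₀)).symmL ℝ (β p))).comp
      ((𝒞.assembleAt (U p) (β p)).comp
        ((trivializationAt E (TangentSpace I : M → Type _) (β p₀)).symmL ℝ (β p))) =
      ∑ i, 𝒞.ρ i (β p) • pullCLM ((𝒞.τ i (β p)).comp (trivSymmL I (β p₀) (β p)))
        (symCLM E (U p i)) := by
    intro p
    rw [precomp_comp_comp_symmL_eq_pullCLM]
    ext a a'
    rw [pullCLM_apply, _root_.sum_apply, _root_.sum_apply]
    change 𝒞.assembleAt (U p) (β p) (trivSymmL I (β p₀) (β p) a) (trivSymmL I (β p₀) (β p) a') = _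
    rw [assembleAt_apply]
    refine Finset.sum_congr rfl fun i _ ↦ ?_
    rw [_root_.smul_apply, _root_.smul_apply, pullCLM_apply, smul_eq_mul]
    rfl
  rw [show (fun p ↦ (ContinuousLinearMap.precomp ℝ
      ((trivializationAt E (TangentSpace I : M → Type _) (β p₀)).symmL ℝ (β p))).comp
      ((𝒞.assembleAt (U p) (β p)).comp
        ((trivializationAt E (TangentSpace I : M → Type _) (β p₀)).symmL ℝ (β p)))) = fun p ↦
      ∑ i, 𝒞.ρ i (β p) • pullCLM ((𝒞.τ i (β p)).comp (trivSymmL I (β p₀) (β p)))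
        (symCLM E (U p i)) from funext key]
  set e₀ := trivializationAt E (TangentSpace I : M → Type _) (β p₀) with he₀
  refine contMDiffWithinAt_finsetSum (t := Finset.univ) fun i _ ↦ ?_
  have hρ : ContMDiffWithinAt IX 𝓘(ℝ, ℝ) ∞ (fun p ↦ 𝒞.ρ i (β p)) A p₀ :=
    (𝒞.contMDiff_ρ i).contMDiffAt.comp_contMDiffWithinAt p₀ hβ
  have hsym : ContMDiffWithinAt IX 𝓘(ℝ, E →L[ℝ] E →L[ℝ] ℝ) ∞ (fun p ↦ symCLM E (U p i)) A p₀ :=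
    (symCLM E).contDiff.contDiffAt.comp_contMDiffWithinAt (hU i)
  by_cases hi : β p₀ ∈ tsupport (𝒞.ρ i)
  · -- near `p₀` the frame composite is the coordinate change of `TM`
    have hsrc : β p₀ ∈ (chartAt H (𝒞.center i)).source := 𝒞.tsupport_subset i hi
    have hb₀ : β p₀ ∈ e₀.baseSet := FiberBundle.mem_baseSet_trivializationAt' (β p₀)
    have hbi : β p₀ ∈ (trivializationAt E (TangentSpace I : M → Type _) (𝒞.center i)).baseSet :=
      mem_baseSet_of_mem_source hsrc
    have hcc : ContMDiffWithinAt IX 𝓘(ℝ, E →L[ℝ] E) ∞ (fun p ↦ (e₀.coordChangeL ℝ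
        (trivializationAt E (TangentSpace I : M → Type _) (𝒞.center i)) (β p) : E →L[ℝ] E))
        A p₀ := hβ.coordChangeL hb₀ hbi
    have hpull : ContMDiffWithinAt IX 𝓘(ℝ, (E →L[ℝ] E →L[ℝ] ℝ) →L[ℝ] (E →L[ℝ] E →L[ℝ] ℝ)) ∞
        (fun p ↦ pullCLM (e₀.coordChangeL ℝ
          (trivializationAt E (TangentSpace I : M → Type _) (𝒞.center i)) (β p) : E →L[ℝ] E))
        A p₀ := (contDiff_pullCLM (E := E) (F := E)).contDiffAt.comp_contMDiffWithinAt hcc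
    have hterm := hρ.smul (hpull.clm_apply hsym)
    have hpt : ∀ p, β p ∈ (chartAt H (β p₀)).source ∩ (chartAt H (𝒞.center i)).source →
        𝒞.ρ i (β p) • pullCLM ((𝒞.τ i (β p)).comp (trivSymmL I (β p₀) (β p)))
          (symCLM E (U p i)) =
        ((fun p ↦ 𝒞.ρ i (β p)) • fun p ↦ pullCLM (e₀.coordChangeL ℝ
          (trivializationAt E (TangentSpace I : M → Type _) (𝒞.center i)) (β p) : E →L[ℝ] E)
          (symCLM E (U p i))) p := by
      intro p hp
      simp only [Pi.smul_apply']
      rw [𝒞.τ_comp_trivSymmL_eq_coordChangeL i (β p₀) hp.1 hp.2]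
    refine hterm.congr_of_eventuallyEq ?_ (hpt p₀ ⟨hb₀', hsrc⟩)
    have hev : ∀ᶠ p in 𝓝[A] p₀, β p ∈ (chartAt H (β p₀)).source ∩ (chartAt H (𝒞.center i)).source :=
      hβ.continuousWithinAt.preimage_mem_nhdsWithin
        (((chartAt H _).open_source.inter (chartAt H _).open_source).mem_nhds ⟨hb₀', hsrc⟩)
    filter_upwards [hev] with p hp
    exact hpt p hp
  · -- near `p₀` the term vanishes
    have h0 : ∀ᶠ y in 𝓝 (β p₀), 𝒞.ρ i y = 0 := notMem_tsupport_iff_eventuallyEq.1 hi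
    have hev0 : ∀ᶠ p in 𝓝[A] p₀, 𝒞.ρ i (β p) = 0 := hβ.continuousWithinAt.eventually h0
    refine (contMDiffWithinAt_const (c := (0 : E →L[ℝ] E →L[ℝ] ℝ))).congr_of_eventuallyEq
      ?_ ?_
    · filter_upwards [hev0] with p hp
      rw [hp, zero_smul]
    · rw [h0.self_of_nhds, zero_smul]


/-! ### Smoothness of the embedding -/

/-- **The embedding `ℰ` at a point**: the bilinear form `B` on `T_x M` read as the value
`(ρᵢ(x) · B(σᵢ ·, σᵢ ·))ᵢ`. [folklore] -/
def embedAt (x : M) (B : TangentSpace I x →L[ℝ] TangentSpace I x →L[ℝ] ℝ) :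
    Fin N → (E →L[ℝ] E →L[ℝ] ℝ) :=
  fun i ↦ 𝒞.ρ i x • pullCLM (𝒞.σ i x) B

omit [IsManifold I ∞ M] in
/-- `ℰ s (x) = ℰ_x (s x)`. [folklore] -/
theorem embed_eq_embedAt [IsManifold I ∞ M]
    (s : Π x : M, TangentSpace I x →L[ℝ] TangentSpace I x →L[ℝ] ℝ) (x : M) :
    𝒞.embed s x = 𝒞.embedAt x (s x) := rfl

/-- The inverse frame of the centre `cᵢ` through the trivialization at `x₀`:
`σᵢ = e_{x₀}⁻¹ ∘ (coordinate change from cᵢ to x₀)` on the common domain. [folklore] -/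
theorem σ_eq_trivSymmL_comp_coordChangeL (i : Fin N) (x₀ : M) {x : M}
    (hx₀ : x ∈ (chartAt H x₀).source) (hxi : x ∈ (chartAt H (𝒞.center i)).source) :
    𝒞.σ i x = (trivSymmL I x₀ x).comp
      ((trivializationAt E (TangentSpace I : M → Type _) (𝒞.center i)).coordChangeL ℝ
        (trivializationAt E (TangentSpace I : M → Type _) x₀) x : E →L[ℝ] E) := by
  rw [← trivCLM_comp_trivSymmL hxi hx₀, ← ContinuousLinearMap.comp_assoc]
  ext a
  rw [ContinuousLinearMap.coe_comp, comp_apply]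
  exact (trivSymmL_trivCLM hx₀ _).symm

/-- **The embedding is smooth**: along a `C^∞` (within `A` at `p₀`) section `p ↦ S p` of the
bundle of bilinear forms over `β : X → M`, the vector-valued map `p ↦ ℰ_{β p} (S p)` is `C^∞`
within `A` at `p₀` (near `p₀` each component is either identically zero or `ρᵢ ∘ β` times the
coordinate expression of `S` in the trivialization at `β p₀`, pulled back along the smooth
coordinate change to the trivialization at `cᵢ`). [folklore] -/
theorem contMDiffWithinAt_embedAt {β : Xm → M}
    {S : Π p : Xm, TangentSpace I (β p) →L[ℝ] TangentSpace I (β p) →L[ℝ] ℝ} {A : Set Xm} {p₀ : Xm}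
    (hS : ContMDiffWithinAt IX (I.prod 𝓘(ℝ, E →L[ℝ] E →L[ℝ] ℝ)) ∞
      (fun p ↦ TotalSpace.mk' (E →L[ℝ] E →L[ℝ] ℝ)
        (E := fun b : M ↦ TangentSpace I b →L[ℝ] TangentSpace I b →L[ℝ] ℝ) (β p) (S p)) A p₀) :
    ContMDiffWithinAt IX 𝓘(ℝ, Fin N → (E →L[ℝ] E →L[ℝ] ℝ)) ∞ (fun p ↦ 𝒞.embedAt (β p) (S p))
      A p₀ := by
  rw [contMDiffWithinAt_bilin_iff] at hS
  obtain ⟨hβ, hcoord⟩ := hS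
  have hb₀' : β p₀ ∈ (chartAt H (β p₀)).source := mem_chart_source H (β p₀)
  -- the coordinate expression of `S` is `pullCLM e₀⁻¹ (S p)`
  have hco : ContMDiffWithinAt IX 𝓘(ℝ, E →L[ℝ] E →L[ℝ] ℝ) ∞
      (fun p ↦ pullCLM (trivSymmL I (β p₀) (β p)) (S p)) A p₀ :=
    hcoord.congr (fun p _ ↦ (precomp_comp_comp_symmL_eq_pullCLM (β p₀) (β p) (S p)).symm)
      (precomp_comp_comp_symmL_eq_pullCLM (β p₀) (β p₀) (S p₀)).symm
  set e₀ := trivializationAt E (TangentSpace I : M → Type _) (β p₀) with he₀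
  rw [contMDiffWithinAt_pi_space]
  intro i
  have hρ : ContMDiffWithinAt IX 𝓘(ℝ, ℝ) ∞ (fun p ↦ 𝒞.ρ i (β p)) A p₀ :=
    (𝒞.contMDiff_ρ i).contMDiffAt.comp_contMDiffWithinAt p₀ hβ
  by_cases hi : β p₀ ∈ tsupport (𝒞.ρ i)
  · have hsrc : β p₀ ∈ (chartAt H (𝒞.center i)).source := 𝒞.tsupport_subset i hi
    have hb₀ : β p₀ ∈ e₀.baseSet := FiberBundle.mem_baseSet_trivializationAt' (β p₀)
    have hbi : β p₀ ∈ (trivializationAt E (TangentSpace I : M → Type _) (𝒞.center i)).baseSet :=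
      mem_baseSet_of_mem_source hsrc
    have hcc : ContMDiffWithinAt IX 𝓘(ℝ, E →L[ℝ] E) ∞ (fun p ↦
        ((trivializationAt E (TangentSpace I : M → Type _) (𝒞.center i)).coordChangeL ℝ e₀ (β p) :
          E →L[ℝ] E)) A p₀ := hβ.coordChangeL hbi hb₀
    have hpull : ContMDiffWithinAt IX 𝓘(ℝ, (E →L[ℝ] E →L[ℝ] ℝ) →L[ℝ] (E →L[ℝ] E →L[ℝ] ℝ)) ∞
        (fun p ↦ pullCLM ((trivializationAt E (TangentSpace I : M → Type _) (𝒞.center i)).coordChangeL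
          ℝ e₀ (β p) : E →L[ℝ] E)) A p₀ :=
      (contDiff_pullCLM (E := E) (F := E)).contDiffAt.comp_contMDiffWithinAt hcc
    have hterm := hρ.smul (hpull.clm_apply hco)
    have hpt : ∀ p, β p ∈ (chartAt H (β p₀)).source ∩ (chartAt H (𝒞.center i)).source →
        𝒞.embedAt (β p) (S p) i =
        ((fun p ↦ 𝒞.ρ i (β p)) • fun p ↦ pullCLM ((trivializationAt E
          (TangentSpace I : M → Type _) (𝒞.center i)).coordChangeL ℝ e₀ (β p) : E →L[ℝ] E)
          (pullCLM (trivSymmL I (β p₀) (β p)) (S p))) p := by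
      intro p hp
      simp only [Pi.smul_apply', embedAt]
      rw [𝒞.σ_eq_trivSymmL_comp_coordChangeL i (β p₀) hp.1 hp.2, pullCLM_comp]
    refine hterm.congr_of_eventuallyEq ?_ (hpt p₀ ⟨hb₀', hsrc⟩)
    have hev : ∀ᶠ p in 𝓝[A] p₀, β p ∈ (chartAt H (β p₀)).source ∩ (chartAt H (𝒞.center i)).source :=
      hβ.continuousWithinAt.preimage_mem_nhdsWithin
        (((chartAt H _).open_source.inter (chartAt H _).open_source).mem_nhds ⟨hb₀', hsrc⟩)
    filter_upwards [hev] with p hp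
    exact hpt p hp
  · have h0 : ∀ᶠ y in 𝓝 (β p₀), 𝒞.ρ i y = 0 := notMem_tsupport_iff_eventuallyEq.1 hi
    have hev0 : ∀ᶠ p in 𝓝[A] p₀, 𝒞.ρ i (β p) = 0 := hβ.continuousWithinAt.eventually h0
    refine (contMDiffWithinAt_const (c := (0 : E →L[ℝ] E →L[ℝ] ℝ))).congr_of_eventuallyEq
      ?_ ?_
    · filter_upwards [hev0] with p hp
      simp only [embedAt, hp, zero_smul]
    · simp only [embedAt, h0.self_of_nhds, zero_smul]

/-- **A `C^∞` metric embeds as a `C^∞` vector-valued function** `ℰ g : M → (Fin N → V)`.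
[folklore] -/
theorem contMDiff_embed (g : PseudoRiemannianMetric I ∞ E (TangentSpace I : M → Type _)) :
    ContMDiff I 𝓘(ℝ, Fin N → (E →L[ℝ] E →L[ℝ] ℝ)) ∞ (𝒞.embed g.val) := fun x ↦
  (𝒞.contMDiffWithinAt_embedAt (β := id) (S := fun x ↦ g.val x) (A := univ)
    (g.contMDiff x).contMDiffWithinAt).contMDiffAt univ_mem

/-- **A family of metrics `C^∞` on `M × S` embeds as a vector-valued function `C^∞` on
`M × S`**: `(x, t) ↦ ℰ (g t) (x)` (`IsContMDiffFamilyOn`). [folklore] -/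
theorem contMDiffOn_embed_family {g : ℝ → PseudoRiemannianMetric I ∞ E (TangentSpace I : M → Type _)}
    {S : Set ℝ} (hg : IsContMDiffFamilyOn ∞ g S) :
    ContMDiffOn (I.prod 𝓘(ℝ, ℝ)) 𝓘(ℝ, Fin N → (E →L[ℝ] E →L[ℝ] ℝ)) ∞
      (fun p : M × ℝ ↦ 𝒞.embed (g p.2).val p.1) (univ ×ˢ S) := fun p hp ↦
  𝒞.contMDiffWithinAt_embedAt (β := fun p : M × ℝ ↦ p.1) (S := fun p ↦ (g p.2).val p.1) (hg p hp)

/-- **A `C^∞` vector-valued function assembles to a `C^∞` family of symmetric forms.**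
[folklore] -/
theorem contMDiff_assemble {U : M → Fin N → (E →L[ℝ] E →L[ℝ] ℝ)}
    (hU : ContMDiff I 𝓘(ℝ, Fin N → (E →L[ℝ] E →L[ℝ] ℝ)) ∞ U) :
    ContMDiff I (I.prod 𝓘(ℝ, E →L[ℝ] E →L[ℝ] ℝ)) ∞
      (fun x ↦ TotalSpace.mk' (E →L[ℝ] E →L[ℝ] ℝ)
        (E := fun b : M ↦ TangentSpace I b →L[ℝ] TangentSpace I b →L[ℝ] ℝ) x (𝒞.assemble U x)) :=
  fun x ↦ (𝒞.contMDiffWithinAt_assembleAt (β := id) (A := univ) contMDiffWithinAt_id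
    (fun i ↦ (contMDiffWithinAt_pi_space.1 (hU x).contMDiffWithinAt i))).contMDiffAt univ_mem

/-- **A vector-valued function `C^∞` on `M × S` assembles to a family of symmetric forms
`C^∞` on `M × S`** (the `IsContMDiffFamilyOn` clause of a flow built from a solution of the
vector-valued system). [folklore] -/
theorem contMDiffOn_assemble_family {U : M × ℝ → Fin N → (E →L[ℝ] E →L[ℝ] ℝ)} {S : Set ℝ}
    (hU : ContMDiffOn (I.prod 𝓘(ℝ, ℝ)) 𝓘(ℝ, Fin N → (E →L[ℝ] E →L[ℝ] ℝ)) ∞ U (univ ×ˢ S)) :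
    ContMDiffOn (I.prod 𝓘(ℝ, ℝ)) (I.prod 𝓘(ℝ, E →L[ℝ] E →L[ℝ] ℝ)) ∞
      (fun p : M × ℝ ↦ TotalSpace.mk' (E →L[ℝ] E →L[ℝ] ℝ)
        (E := fun b : M ↦ TangentSpace I b →L[ℝ] TangentSpace I b →L[ℝ] ℝ) p.1
        (𝒞.assembleAt (U p) p.1)) (univ ×ˢ S) := fun p hp ↦
  𝒞.contMDiffWithinAt_assembleAt (β := fun p : M × ℝ ↦ p.1) contMDiffWithinAt_fst
    (fun i ↦ contMDiffWithinAt_pi_space.1 (hU p hp) i)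

/-! ### The components of `𝒜 U` in a chart: the coefficient map -/

/-- **The coefficient map of the chart at `z`**: the linear map
`w ↦ ∑ᵢ ρᵢ(x) · sym(wᵢ)(τᵢ e_z⁻¹ ·, τᵢ e_z⁻¹ ·)` on `Fin N → V`, so that the components of
`𝒜 U` in the trivialization at `z` are `coeffCLM z x (U x)` (`pullCLM_symmL_assembleAt`).
[folklore] -/
def coeffCLM (z x : M) : (Fin N → (E →L[ℝ] E →L[ℝ] ℝ)) →L[ℝ] (E →L[ℝ] E →L[ℝ] ℝ) :=
  ∑ i, 𝒞.ρ i x • (pullCLM ((𝒞.τ i x).comp (trivSymmL I z x))).comp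
    ((symCLM E).comp (ContinuousLinearMap.proj i))

/-- `coeffCLM z x w (a, a') = ∑ᵢ ρᵢ(x) sym(wᵢ)(τᵢ e_z⁻¹ a, τᵢ e_z⁻¹ a')`. [folklore] -/
theorem coeffCLM_apply (z x : M) (w : Fin N → (E →L[ℝ] E →L[ℝ] ℝ)) (a a' : E) :
    𝒞.coeffCLM z x w a a' = ∑ i, 𝒞.ρ i x *
      symCLM E (w i) (𝒞.τ i x (trivSymmL I z x a)) (𝒞.τ i x (trivSymmL I z x a')) := by
  simp only [coeffCLM]
  rw [_root_.sum_apply, _root_.sum_apply, _root_.sum_apply]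
  refine Finset.sum_congr rfl fun i _ ↦ ?_
  rw [_root_.smul_apply, _root_.smul_apply, _root_.smul_apply, smul_eq_mul,
    ContinuousLinearMap.coe_comp, comp_apply, ContinuousLinearMap.coe_comp, comp_apply,
    pullCLM_apply, ContinuousLinearMap.coe_comp, comp_apply, comp_apply]
  rfl

/-- **The components of `𝒜` in the trivialization at `z` are given by the coefficient map**:
`(𝒜_x w)(e_z⁻¹ a, e_z⁻¹ a') = coeffCLM z x w (a, a')`. [folklore] -/
theorem pullCLM_trivSymmL_assembleAt (z x : M) (w : Fin N → (E →L[ℝ] E →L[ℝ] ℝ)) :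
    pullCLM (trivSymmL I z x) (𝒞.assembleAt w x) = 𝒞.coeffCLM z x w := by
  ext a a'
  rw [pullCLM_apply, coeffCLM_apply]
  exact 𝒞.assembleAt_apply w x _ _

/-- **The chart representative of an assembled metric**: if a metric `g` has `g.val = 𝒜 U`, its
representative in the chart at `z` (`chartRep`, `RicciDeTurckChartFamily.lean`) is
`y ↦ coeffCLM z (φ_z⁻¹ y) (U (φ_z⁻¹ y))`, `φ_z = extChartAt I z` — a smooth family of linear maps
applied to the chart values of `U`. [folklore] -/
theorem chartRep_eq_coeffCLM {g : PseudoRiemannianMetric I ∞ E (TangentSpace I : M → Type _)}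
    {U : M → Fin N → (E →L[ℝ] E →L[ℝ] ℝ)} (hg : ∀ x, g.val x = 𝒞.assemble U x) (z : M) (t : ℝ)
    (y : E) :
    chartRep I (fun _ ↦ g) z t y =
      𝒞.coeffCLM z ((extChartAt I z).symm y) (U ((extChartAt I z).symm y)) := by
  rw [← pullCLM_trivSymmL_assembleAt, chartRep, gramOpFamily, ← pullCLM_eq_bilinearComp, hg]
  rfl

set_option synthInstance.maxHeartbeats 200000 in
-- instance search through the nested operator space `(Fin N → V) →L V`, `V = E →L E →L ℝ`
/-- **The coefficient map is `C^∞` on the chart domain of `z`** (as for `𝒜`: each term is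
locally either zero or `ρᵢ` times the pullback along the smooth coordinate change of `TM` from
the trivialization at `z` to that at `cᵢ`). [folklore] -/
theorem contMDiffOn_coeffCLM (z : M) :
    ContMDiffOn I 𝓘(ℝ, (Fin N → (E →L[ℝ] E →L[ℝ] ℝ)) →L[ℝ] (E →L[ℝ] E →L[ℝ] ℝ)) ∞
      (𝒞.coeffCLM z) (chartAt H z).source := by
  intro x₀ hx₀
  have hb₀ : x₀ ∈ (trivializationAt E (TangentSpace I : M → Type _) z).baseSet :=
    mem_baseSet_of_mem_source hx₀
  set e₀ := trivializationAt E (TangentSpace I : M → Type _) z with he₀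
  unfold coeffCLM
  refine contMDiffWithinAt_finsetSum (t := Finset.univ) fun i _ ↦ ?_
  have hρ : ContMDiffWithinAt I 𝓘(ℝ, ℝ) ∞ (𝒞.ρ i) (chartAt H z).source x₀ :=
    (𝒞.contMDiff_ρ i).contMDiffAt.contMDiffWithinAt
  have hL : ContMDiffWithinAt I 𝓘(ℝ, (Fin N → (E →L[ℝ] E →L[ℝ] ℝ)) →L[ℝ] (E →L[ℝ] E →L[ℝ] ℝ)) ∞
      (fun _ : M ↦ (symCLM E).comp (ContinuousLinearMap.proj (R := ℝ)
        (φ := fun _ : Fin N ↦ E →L[ℝ] E →L[ℝ] ℝ) i)) (chartAt H z).source x₀ :=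
    contMDiffWithinAt_const
  by_cases hi : x₀ ∈ tsupport (𝒞.ρ i)
  · have hsrc : x₀ ∈ (chartAt H (𝒞.center i)).source := 𝒞.tsupport_subset i hi
    have hbi : x₀ ∈ (trivializationAt E (TangentSpace I : M → Type _) (𝒞.center i)).baseSet :=
      mem_baseSet_of_mem_source hsrc
    have hcc : ContMDiffWithinAt I 𝓘(ℝ, E →L[ℝ] E) ∞ (fun x ↦ (e₀.coordChangeL ℝ
        (trivializationAt E (TangentSpace I : M → Type _) (𝒞.center i)) x : E →L[ℝ] E))
        (chartAt H z).source x₀ := contMDiffWithinAt_id.coordChangeL hb₀ hbi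
    have hpull : ContMDiffWithinAt I 𝓘(ℝ, (E →L[ℝ] E →L[ℝ] ℝ) →L[ℝ] (E →L[ℝ] E →L[ℝ] ℝ)) ∞
        (fun x ↦ pullCLM (e₀.coordChangeL ℝ
          (trivializationAt E (TangentSpace I : M → Type _) (𝒞.center i)) x : E →L[ℝ] E))
        (chartAt H z).source x₀ :=
      (contDiff_pullCLM (E := E) (F := E)).contDiffAt.comp_contMDiffWithinAt hcc
    have hterm := hρ.smul (hpull.clm_comp hL)
    have hpt : ∀ x, x ∈ (chartAt H z).source ∩ (chartAt H (𝒞.center i)).source →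
        𝒞.ρ i x • (pullCLM ((𝒞.τ i x).comp (trivSymmL I z x))).comp
          ((symCLM E).comp (ContinuousLinearMap.proj i)) =
        (𝒞.ρ i • fun x ↦ (pullCLM (e₀.coordChangeL ℝ
          (trivializationAt E (TangentSpace I : M → Type _) (𝒞.center i)) x : E →L[ℝ] E)).comp
          ((symCLM E).comp (ContinuousLinearMap.proj (R := ℝ)
            (φ := fun _ : Fin N ↦ E →L[ℝ] E →L[ℝ] ℝ) i))) x := by
      intro x hx
      simp only [Pi.smul_apply']
      rw [𝒞.τ_comp_trivSymmL_eq_coordChangeL i z hx.1 hx.2]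
    refine hterm.congr_of_eventuallyEq ?_ (hpt x₀ ⟨hx₀, hsrc⟩)
    have hev : ∀ᶠ x in 𝓝[(chartAt H z).source] x₀,
        x ∈ (chartAt H z).source ∩ (chartAt H (𝒞.center i)).source :=
      mem_nhdsWithin_of_mem_nhds
        (((chartAt H _).open_source.inter (chartAt H _).open_source).mem_nhds ⟨hx₀, hsrc⟩)
    filter_upwards [hev] with x hx
    exact hpt x hx
  · have h0 : ∀ᶠ y in 𝓝 x₀, 𝒞.ρ i y = 0 := notMem_tsupport_iff_eventuallyEq.1 hi
    have hz : ∀ T : (Fin N → (E →L[ℝ] E →L[ℝ] ℝ)) →L[ℝ] (E →L[ℝ] E →L[ℝ] ℝ), (0 : ℝ) • T = 0 :=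
      fun T ↦ zero_smul ℝ T
    refine (contMDiffWithinAt_const (c := (0 : (Fin N → (E →L[ℝ] E →L[ℝ] ℝ)) →L[ℝ]
      (E →L[ℝ] E →L[ℝ] ℝ)))).congr_of_eventuallyEq ?_ ?_
    · filter_upwards [mem_nhdsWithin_of_mem_nhds h0] with x hx
      rw [show 𝒞.ρ i x = 0 from hx]
      exact hz _
    · rw [show 𝒞.ρ i x₀ = 0 from h0.self_of_nhds]
      exact hz _

/-- **The coefficient map read in the chart is `C^∞` on the chart target**:
`y ↦ coeffCLM z (φ_z⁻¹ y)` on `(extChartAt I z).target`. [folklore] -/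
theorem contDiffOn_coeffCLM_symm (z : M) :
    ContDiffOn ℝ ∞ (fun y ↦ 𝒞.coeffCLM z ((extChartAt I z).symm y)) (extChartAt I z).target := by
  rw [← contMDiffOn_iff_contDiffOn]
  refine (𝒞.contMDiffOn_coeffCLM z).comp (contMDiffOn_extChartAt_symm z) fun y hy ↦ ?_
  rw [← extChartAt_source I]
  exact (extChartAt I z).map_target hy

/-- **`ℰ ∘ 𝒜` through the coefficient maps**: `(ℰ (𝒜 U))(x)ᵢ = ρᵢ(x) · coeffCLM cᵢ x (U x)`.
[folklore] -/
theorem embed_assemble_apply (U : M → Fin N → (E →L[ℝ] E →L[ℝ] ℝ)) (x : M) (i : Fin N) :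
    𝒞.embed (𝒞.assemble U) x i = 𝒞.ρ i x • 𝒞.coeffCLM (𝒞.center i) x (U x) := by
  rw [← pullCLM_trivSymmL_assembleAt]
  rfl

end Smoothness

end ChartCover

end Literature.Geometry.Riemannian

end
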